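import Literature.Combinatorics.SetFamily.CubeMiddleLayerInstance
import Mathlib.Analysis.SpecialFunctions.Pow.Real
import Mathlib.Analysis.SpecialFunctions.Log.Base
import HarnessLib
import HarnessLib.Audit

/-!
# The Alekseev–Gaevoy union-stability conjecture (ECCC TR26-007, Conj. 1.4) — typed, and refuted

Context: the Res(⊕) rung of the PneNP proof-complexity ladder (routes `ReslinSizeFromWidth`,
`ReslinMediumCover`, `RevResPhpExactCovers`; crux `ResLinSizeFromWidth` = stmt-PneNP-18932). Size lower
bounds for dag-like Res(⊕) are known only up to depth `N^{2−ε}` (random walks with restarts: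
[EGI24, AI25, EI25, BI25, BC25/BBCI26]). Y. Alekseev and N. Gaevoy, *New Polynomial-Depth Res(⊕) Lower
Bounds*, ECCC TR26-007 (Report No. 7, 2026; unrefereed; no revision listed as of 2026-08-19)
[AlekseevGaevoy2026b], propose "layer counting" to pass `N²`; their Res(⊕) theorem is CONDITIONAL:

* p. 2, Theorem 1.1 (= Theorem 4.3, p. 12): *"Suppose that Conjecture 1.4 holds for q > 1 and
  r = k − 2. Then any Res(⊕) refutation of CBPHP^{N,M}_{k,f} of size at most 2^{(log N)^{q/2}}
  requires depth d such that d ≥ Ω(N^{(k−2)·c}), where c > 0 only depends on q."*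
* pp. 5–6, Conjecture 1.4 (verbatim; = Conjecture 4.2, §4 p. 11): *"Let r and q be some constants
  greater than 0. Let Φ₁, …, Φ_m be collections of affine subspaces of 𝔽₂ⁿ of codimention at most
  (log n)^q such that |⋃_{j∈[m]} Φ_j| ≥ 2^{n−1}. For each i ∈ [m] let Φ′_i be any subset of Φ_i
  such that |Φ′_i| ≥ (1 − 1/n^r)|Φ_i|. Then there is a constant c > 0, depending only on q, such
  that |⋃_{j∈[m]} Φ′_j| ≥ (1 − 1/n^{r·c}) |⋃_{j∈[m]} Φ_j|."*
* p. 6: *"The reason why we believe this conjecture is true is the following: any naive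
  counterexample has the structure of a sunflower in the sense that all Φ′_j belong to some core, and
  Φ_j ∖ Φ′_j are petals. Intuitively, it seems like it is impossible to construct such a sunflower
  using affine subspaces."*

**This file.** `UnionStableAt n q r c` is the displayed implication at one dimension `n` and one
constant `c`; `UnionStabilityConjecture` (closed: for all `q, r > 0` SOME `c > 0` works in every `n` — the pointwise
reading) and `UnionStabilityConjectureUniform` (the printed shape: `c = c(q)` good for every `r > 0`)
are the `@[conjecture]` obligation nodes (cited to where they are STATED; never asserted), as is the
parametric one-dimension node `UnionStableAt`.
THEOREMS (all proved, standard axioms): `unionStableAt_false_of_large` — for `q > 1`, `r > 0`,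
`c > 0` the statement fails at EVERY large `n`; hence `no_unionStability_constant` (for every `q > 1`,
`r > 0` NO `c` works — in particular for the parameters `q > 1`, `r = k − 2` of Theorem 1.1),
`not_eventually_unionStableAt` (no "for all large n" repair), `not_unionStabilityConjecture` and
`not_unionStabilityConjectureUniform` (the closed conjecture, pointwise and printed readings, both
UNCONDITIONALLY false), `no_unionStability_constant_q_one` (`q = 1`, `0 < r < 1`).

**The counterexample** (Literature: `Literature.Combinatorics.SetFamily.CubeMiddleLayer.middle_layer_instance`,
files `CubeMiddleLayer*.lean`). For `n` large put `k = ⌈r·log₂ n⌉`, pick `|A| = 2k` and take the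
`C(2k,k)` coordinate subcubes `Φ_S = {x : x_S = 1}`, `S ∈ (A choose k)` — affine subspaces of
codimension exactly `k ≤ (log₂ n)^q` (for `q > 1`). Their union `U = {wt_A ≥ k}` has `|U| ≥ 2^{n−1}`.
Delete from every member the middle layer `B = {wt_A = k}`: each member loses EXACTLY the fraction
`2^{−k} ≤ n^{−r}`, the union loses all of `B`, and `|B| ≥ |U|/(2√k)` (`C(2k,k) ≥ 4^k/(2√k)`), while
`1/(2√k) = 1/(2√⌈r log₂ n⌉) > n^{−rc}` for every constant `c > 0` and `n` large. The family IS the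
"sunflower made of affine subspaces" of p. 6: large petals `Φ_S ∖ B` around the thin common core `B`.

**Census wording (Res(⊕) ladder).** The hypothesis of TR26-007 Theorem 1.1 (= 4.3) is false for every
`q > 1`, `r > 0` (and no `c(q)` exists); the report's UNCONDITIONAL results (Thm 1.2 for RevRes(⊕),
Thm 1.3 depth `N^{2−ε}`) are untouched; nothing here bounds Res(⊕) itself, and the polynomial-depth
frontier stays at `N^{2−ε}`. Whether a repaired union-stability statement (loss exponent tied to the
codimension budget; families without a thin common layer) rescues layer counting is not addressed.

Rendering decisions. Affine subspace of codimension `d` = `CubeMiddleLayer.IsAffineFlatOfCodim` (coset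
`a + W`, `dim W + d = n`; nonempty, as in print where the `Φ_j` carry points); cardinalities are
`Set.ncard`; `log` = `log₂` (computer-science default; immaterial for `q > 1`); the conjecture is
stated for EVERY `n` (print fixes no range) and refuted also in the "eventually" reading. NOT typed:
`CBPHP^{N,M}_{k,f}` (§3), parity decision DAGs (Def. 2.2; cf. `Literature…RevResLin` /
`Literature…ResLin.resLinDepth`), Theorems 1.2/1.3/4.1.

Provenance / honesty. Counterexample and Lean proof come from an internal, unpublished manuscript of
an earlier programme (2026-08); re-landed here adapted to the tree; NOT cited as a source anywhere —
the only cited source is the conjecture's own statement. No revision of TR26-007 and no published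
refutation were found (ECCC, arXiv, held corpus; 2026-08-19).

-- adapted from reserve/prior-2001/Prior/PneNP/PneNP/Pnp_Y3DaglikeReslinWidthAndLayerCounting_MiddleLayerCounterexample.lean
-- (internal 2001 programme; `AGConjecture` / `AG_conjecture_false*`), renamed, eventual form added.
-/

namespace Summit.PneNP.PneNP.Theorems

-- `Summit.PneNP.PneNP` repeats a path component by design (summit = sub-problem); silence the linter.
set_option linter.dupNamespace false

open Literature.Combinatorics.SetFamily Literature.Combinatorics.SetFamily.CubeMiddleLayer

/-- **Alekseev–Gaevoy union stability at ONE dimension `n` and ONE constant `c`** (the displayed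
implication of ECCC TR26-007 §1.2, statement (1.4), pp. 5–6): for every finite family
`Φ : ι → Set 𝔽₂ⁿ` of affine subspaces of codimension at most `(log₂ n)^q` whose union has at least
`2^{n−1}` points, and every choice of subsets `Φ' i ⊆ Φ i` with `|Φ' i| ≥ (1 − n^{−r})·|Φ i|`, the
union of the `Φ' i` keeps at least a `(1 − n^{−r·c})` fraction of the union of the `Φ i`. A
parametric obligation node in `n q r c` (REFUTED below for `q > 1`, `r, c > 0` and every large `n`:
`unionStableAt_false_of_large`). [cite: AlekseevGaevoy2026b, Conjecture 1.4 (pp. 5–6), displayed implication]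
[status: refuted here for q > 1 and all large n] -/
@[conjecture] def UnionStableAt (n : ℕ) (q r c : ℝ) : Prop :=
  ∀ (ι : Type) (_ : Fintype ι) (Φ Φ' : ι → Set (Fin n → ZMod 2)),
    (∀ i, ∃ d : ℕ, IsAffineFlatOfCodim (Φ i) d ∧ (d : ℝ) ≤ (Real.logb 2 n) ^ q) →
    2 ^ (n - 1) ≤ (⋃ i, Φ i).ncard →
    (∀ i, Φ' i ⊆ Φ i) →
    (∀ i, (1 - (n : ℝ) ^ (-r)) * ((Φ i).ncard : ℝ) ≤ ((Φ' i).ncard : ℝ)) →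
    (1 - (n : ℝ) ^ (-(r * c))) * ((⋃ i, Φ i).ncard : ℝ) ≤ ((⋃ i, Φ' i).ncard : ℝ)

/-- **Conjecture 1.4 (= 4.2) of Alekseev–Gaevoy, ECCC TR26-007** (closed form, the POINTWISE
reading: for all constants `q, r > 0` there is SOME constant `c > 0` — allowed to depend on `q` and
`r` — such that union stability `UnionStableAt n q r c` holds in every dimension `n`). The printed
text asks for MORE (`c` depending only on `q`, `UnionStabilityConjectureUniform`, which implies this
def — see the proof of `not_unionStabilityConjectureUniform`), and its Theorem 1.1 (= 4.3) consumes exactly the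
instances `q > 1`, `r = k − 2` of this pointwise form. An obligation node, cited to where it is
stated, never asserted; REFUTED below (`not_unionStabilityConjecture`; indeed NO `c` exists for ANY
`q > 1`, `r > 0`: `no_unionStability_constant`).
[cite: AlekseevGaevoy2026b, Conjecture 1.4 (pp. 5–6) = Conjecture 4.2 (p. 11)] [status: refuted here] -/
@[conjecture] def UnionStabilityConjecture : Prop :=
  ∀ q r : ℝ, 0 < q → 0 < r → ∃ c : ℝ, 0 < c ∧ ∀ n : ℕ, UnionStableAt n q r c

/-- **Conjecture 1.4 in its printed quantifier shape**: *"Let r and q be some constants greater than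
0 … Then there is a constant c > 0, depending only on q, such that …"* — for all `q > 0` there is
`c = c(q) > 0` that works for every `r > 0` and every `n`. Implies the pointwise form
`UnionStabilityConjecture`; REFUTED below (`not_unionStabilityConjectureUniform`).
[cite: AlekseevGaevoy2026b, Conjecture 1.4 (pp. 5–6)] [status: refuted here] -/
@[conjecture] def UnionStabilityConjectureUniform : Prop :=
  ∀ q : ℝ, 0 < q → ∃ c : ℝ, 0 < c ∧ ∀ r : ℝ, 0 < r → ∀ n : ℕ, UnionStableAt n q r c

/-- **Failure at every large dimension.** For `q > 1`, `r > 0`, `c > 0` there is `N ≥ 2` such that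
`UnionStableAt n q r c` FAILS for every `n ≥ N`: the middle-layer family
(`CubeMiddleLayer.middle_layer_instance`) fits the codimension budget `(log₂ n)^q`
(`CubeMiddleLayer.side_condition_of_one_lt`) and violates the conclusion strictly. -/
theorem unionStableAt_false_of_large (r q c : ℝ) (hr : 0 < r) (hq : 1 < q) (hc : 0 < c) :
    ∃ N : ℕ, 2 ≤ N ∧ ∀ n : ℕ, N ≤ n → ¬ UnionStableAt n q r c := by
  obtain ⟨N₁, hN₁2, hN₁⟩ := middle_layer_instance r c hr hc
  obtain ⟨N₂, -, hN₂⟩ := side_condition_of_one_lt r q hr hq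
  refine ⟨max N₁ N₂, le_trans hN₁2 (le_max_left _ _), fun n hn H => ?_⟩
  obtain ⟨ι, inst, Φ, Φ', hcodim, hhalf, hsub, hdel, -, hfail⟩ :=
    hN₁ n (le_trans (le_max_left _ _) hn)
  have hside := hN₂ n (le_trans (le_max_right _ _) hn)
  have hcodim' : ∀ i, ∃ d : ℕ, IsAffineFlatOfCodim (Φ i) d ∧ (d : ℝ) ≤ (Real.logb 2 n) ^ q :=
    fun i => ⟨⌈r * Real.logb 2 n⌉₊, hcodim i, hside⟩
  exact absurd (H ι inst Φ Φ' hcodim' hhalf hsub hdel) (not_le.mpr hfail)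

/-- **No constant `c` exists for any `q > 1`, `r > 0`**: for every `c > 0` union stability fails
(in every large dimension). These are exactly the parameters `q > 1`, `r = k − 2` under which
TR26-007 Theorem 1.1 (= 4.3) invokes Conjecture 1.4. -/
theorem no_unionStability_constant (q r : ℝ) (hq : 1 < q) (hr : 0 < r) :
    ¬ ∃ c : ℝ, 0 < c ∧ ∀ n : ℕ, UnionStableAt n q r c := by
  rintro ⟨c, hc, hall⟩
  obtain ⟨N, -, hN⟩ := unionStableAt_false_of_large r q c hr hq hc
  exact hN N le_rfl (hall N)

/-- The "for all sufficiently large `n`" repair fails too: for `q > 1`, `r, c > 0` there is no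
threshold `N₀` past which `UnionStableAt n q r c` holds. -/
theorem not_eventually_unionStableAt (r q c : ℝ) (hr : 0 < r) (hq : 1 < q) (hc : 0 < c) :
    ¬ ∃ N₀ : ℕ, ∀ n : ℕ, N₀ ≤ n → UnionStableAt n q r c := by
  rintro ⟨N₀, hN₀⟩
  obtain ⟨N, -, hN⟩ := unionStableAt_false_of_large r q c hr hq hc
  exact hN (max N N₀) (le_max_left _ _) (hN₀ (max N N₀) (le_max_right _ _))

/-- **The Alekseev–Gaevoy union-stability Conjecture 1.4 (= 4.2, ECCC TR26-007) is false** (pointwise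
reading, hence a fortiori as printed): already for `q = 2`, `r = 1` no constant `c > 0` works.
Witness: the middle layer of the cube (`Literature…CubeMiddleLayer.middle_layer_instance`). -/
theorem not_unionStabilityConjecture : ¬ UnionStabilityConjecture := fun H =>
  no_unionStability_constant 2 1 one_lt_two one_pos (H 2 1 (by norm_num) one_pos)

/-- **Conjecture 1.4 in its printed quantifier shape is false.** -/
theorem not_unionStabilityConjectureUniform : ¬ UnionStabilityConjectureUniform := fun h =>
  not_unionStabilityConjecture fun q r hq hr => by
    obtain ⟨c, hc, hcq⟩ := h q hq
    exact ⟨c, hc, hcq r hr⟩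

/-- **No exponent `c(1) > 0` exists for `q = 1` either** (reading `log` as `log₂`): for every
`0 < r < 1` no `c > 0` gives union stability in all dimensions (the codimension `⌈r log₂ n⌉` fits the
budget `log₂ n`, `CubeMiddleLayer.side_condition_of_lt_one`). -/
theorem no_unionStability_constant_q_one (r : ℝ) (hr0 : 0 < r) (hr1 : r < 1) :
    ¬ ∃ c : ℝ, 0 < c ∧ ∀ n : ℕ, UnionStableAt n 1 r c := by
  rintro ⟨c, hc, H⟩
  obtain ⟨N₁, -, hN₁⟩ := middle_layer_instance r c hr0 hc
  obtain ⟨N₂, -, hN₂⟩ := side_condition_of_lt_one r hr0 hr1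
  set n₀ : ℕ := max N₁ N₂ with hn₀
  obtain ⟨ι, inst, Φ, Φ', hcodim, hhalf, hsub, hdel, -, hfail⟩ := hN₁ n₀ (le_max_left _ _)
  have hside := hN₂ n₀ (le_max_right _ _)
  have hcodim' : ∀ i, ∃ d : ℕ, IsAffineFlatOfCodim (Φ i) d
      ∧ (d : ℝ) ≤ (Real.logb 2 n₀) ^ (1:ℝ) :=
    fun i => ⟨⌈r * Real.logb 2 n₀⌉₊, hcodim i, hside⟩
  exact absurd (H n₀ ι inst Φ Φ' hcodim' hhalf hsub hdel) (not_le.mpr hfail)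

end Summit.PneNP.PneNP.Theorems
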